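import Summits.ResolutionOfSingularities.ResolutionOfSingularities.Theorems.ValuativeTorsorToLurelFfiniteTransport
import Mathlib.FieldTheory.IntermediateField.Adjoin.Basic
import Mathlib.RingTheory.Adjoin.FG

/-!
# `Valuative.TorsorToLurelFfinite`: climbing a `p`-radical tower with the torsor crux

Route `ResolutionOfSingularities/Valuative`, support item `TorsorToLurelFfinite`
(stmt-ResolutionOfSingularities-0643). Helper file.

Throughout, `F` is a field of characteristic `p`, `K ⊇ F` a field, `O` a valuation ring of `K`,
and the standing hypothesis `hT` is the torsor crux `LuAlphaPTorsor` at the prime `p` (local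
uniformization of `α_p`-torsors `t^p = a` over bases regular at the centre, for ALL ground
fields of characteristic `p`). An *`F`-chart* is a finitely generated `F`-subalgebra `A ⊆ O`
whose localisation at the centre `𝔪_O ∩ A` is a regular local ring.

* `torsor_step` — one application of the crux INSIDE `K`: if `A₀` is an `F`-chart and `t ∈ O`
  with `t ^ p ∈ A₀`, there is an `F`-chart `A ⊇ A₀ ∪ {t}` with `F(A) = F(A₀, t)`. (The crux is
  applied to the subfield `E = F(A₀, t)` made into a type, the valuation ring `O ∩ E` and the
  copy of `A₀` in `E`; regularity at the centre is moved in and out of `E` by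
  `isRegularLocalRing_centre_map_iff`.)
* `torsor_step_of_pow_mem_adjoin` — the same when only `t ^ p ∈ F(A₀) = Frac A₀` (scale `t` by
  a denominator).
* `torsor_root` — adjoining a `pⁿ`-th root: `t ∈ O`, `t ^ p ^ n ∈ F(A₀)`.
* `torsor_roots` — adjoining finitely many such elements.
-/

noncomputable section

set_option linter.dupNamespace false -- mandated namespace of this single-conjunct summit

open IsLocalRing

namespace Summit.ResolutionOfSingularities.ResolutionOfSingularities.Theorems

section

variable {p : ℕ}
  (hT : ∀ (k K : Type) [Field k] [CharP k p] [Field K] [Algebra k K] (O : ValuationSubring K)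
    (A₀ : Subalgebra k K) (h₀ : A₀.toSubring ≤ O.toSubring) (t : K), A₀.FG → t ^ p ∈ A₀ →
    IsFractionRing (Algebra.adjoin k (insert t (A₀ : Set K))) K →
    IsRegularLocalRing (Localization.AtPrime
      (Ideal.comap (Subring.inclusion h₀) (maximalIdeal O))) →
    ∃ (A : Subalgebra k K) (h : A.toSubring ≤ O.toSubring), A₀ ≤ A ∧ t ∈ A ∧ A.FG ∧
      IsFractionRing A K ∧
      IsRegularLocalRing (Localization.AtPrime (Ideal.comap (Subring.inclusion h) (maximalIdeal O))))
  {F K : Type} [Field F] [CharP F p] [Field K] [Algebra F K] (O : ValuationSubring K)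

include hT

/-- **One application of the torsor crux inside `K`.** If `A₀ ⊆ O` is a finitely generated
`F`-subalgebra regular at the centre and `t ∈ O` with `t ^ p ∈ A₀`, then (by the crux applied
to the subfield `E = F(A₀, t)`, the valuation ring `O ∩ E` and the copy of `A₀` inside `E`) there
is a finitely generated `F`-subalgebra `A` with `A₀ ∪ {t} ⊆ A ⊆ O`, regular at the centre, and
generating the same subfield as `A₀ ∪ {t}`. -/
theorem torsor_step (A₀ : Subalgebra F K) (h₀ : A₀.toSubring ≤ O.toSubring) (hfg : A₀.FG)
    (hreg : IsRegularLocalRing (Localization.AtPrime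
      (Ideal.comap (Subring.inclusion h₀) (maximalIdeal O))))
    (t : K) (htp : t ^ p ∈ A₀) :
    ∃ (A : Subalgebra F K) (h : A.toSubring ≤ O.toSubring), A₀ ≤ A ∧ t ∈ A ∧ A.FG ∧
      IsRegularLocalRing (Localization.AtPrime
        (Ideal.comap (Subring.inclusion h) (maximalIdeal O))) ∧
      IntermediateField.adjoin F (A : Set K) =
        IntermediateField.adjoin F (insert t (A₀ : Set K)) := by
  classical
  set E : IntermediateField F K := IntermediateField.adjoin F (insert t (A₀ : Set K)) with hE
  let ι : E →+* K := (E.val : E →ₐ[F] K)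
  have hι : ∀ x : E, ι x = (x : K) := fun _ => rfl
  let O' : ValuationSubring E := O.comap ι
  let A₀' : Subalgebra F E := A₀.comap E.val
  have htE : t ∈ E := IntermediateField.subset_adjoin F _ (Set.mem_insert t _)
  have hA₀E : A₀ ≤ E.val.range := by
    intro x hx
    exact ⟨⟨x, IntermediateField.subset_adjoin F _ (Set.mem_insert_of_mem t hx)⟩, rfl⟩
  have hmap : A₀'.map E.val = A₀ := Subalgebra.map_comap_eq_self hA₀E
  let t' : E := ⟨t, htE⟩
  -- hypotheses of the crux for the data inside `E`
  have h₀' : A₀'.toSubring ≤ O'.toSubring := by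
    intro x hx
    change ι x ∈ O
    exact h₀ (show (x : K) ∈ A₀ from hx)
  have hfg' : A₀'.FG :=
    Subalgebra.fg_of_fg_map _ E.val (fun _ _ h => Subtype.ext h) (by rw [hmap]; exact hfg)
  have htp' : t' ^ p ∈ A₀' := by
    change E.val (t' ^ p) ∈ A₀
    simpa using htp
  have hadj : (Algebra.adjoin F (insert t' (A₀' : Set E))).map E.val =
      Algebra.adjoin F (insert t (A₀ : Set K)) := by
    have himg : (E.val : E → K) '' (A₀' : Set E) = (A₀ : Set K) := by
      rw [← Subalgebra.coe_map, hmap]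
    rw [AlgHom.map_adjoin, Set.image_insert_eq, himg]
    rfl
  have hfrac' : IsFractionRing (Algebra.adjoin F (insert t' (A₀' : Set E))) E := by
    refine IsFractionRing.of_field _ E fun z => ?_
    have hz : (z : K) ∈ IntermediateField.adjoin F (insert t (A₀ : Set K)) := z.2
    obtain ⟨r, hr, s, hs, hrs⟩ := IntermediateField.mem_adjoin_iff_div.mp hz
    rw [← hadj] at hr hs
    obtain ⟨r', hr', rfl⟩ := Subalgebra.mem_map.mp hr
    obtain ⟨s', hs', rfl⟩ := Subalgebra.mem_map.mp hs
    refine ⟨⟨r', hr'⟩, ⟨s', hs'⟩, Subtype.ext ?_⟩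
    simpa using hrs
  have hreg' : IsRegularLocalRing (Localization.AtPrime
      (Ideal.comap (Subring.inclusion h₀') (maximalIdeal O'))) := by
    have hB : A₀'.toSubring.map ι = A₀.toSubring := by
      ext x
      constructor
      · rintro ⟨y, hy, rfl⟩
        exact hy
      · intro hx
        obtain ⟨y, rfl⟩ := hA₀E hx
        exact ⟨y, hx, rfl⟩
    exact (isRegularLocalRing_centre_map_iff ι O A₀'.toSubring A₀.toSubring hB h₀' h₀).mpr hreg
  -- apply the crux inside `E`
  obtain ⟨A', h', hle', ht', hfgA', -, hregA'⟩ := hT F E O' A₀' h₀' t' hfg' htp' hfrac' hreg'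
  -- push the chart forward to `K`
  let A : Subalgebra F K := A'.map E.val
  have h : A.toSubring ≤ O.toSubring := by
    rintro _ ⟨y, hy, rfl⟩
    exact h' hy
  refine ⟨A, h, ?_, ⟨t', ht', rfl⟩, hfgA'.map _, ?_, ?_⟩
  · rw [← hmap]
    exact Subalgebra.map_mono hle'
  · have hB : A'.toSubring.map ι = A.toSubring := by
      ext x
      constructor
      · rintro ⟨y, hy, rfl⟩
        exact ⟨y, hy, rfl⟩
      · rintro ⟨y, hy, rfl⟩
        exact ⟨y, hy, rfl⟩
    exact (isRegularLocalRing_centre_map_iff ι O A'.toSubring A.toSubring hB h' h).mp hregA'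
  · refine le_antisymm ?_ ?_
    · rw [IntermediateField.adjoin_le_iff]
      rintro _ ⟨y, -, rfl⟩
      exact y.2
    · apply IntermediateField.adjoin.mono
      rintro x (rfl | hx)
      · exact ⟨t', ht', rfl⟩
      · rw [← hmap] at hx
        obtain ⟨y, hy, rfl⟩ := Subalgebra.mem_map.mp hx
        exact ⟨y, hle' hy, rfl⟩

omit [CharP F p] hT in
/-- `F(x, S) = F(x) ⊔ F(S)`. -/
theorem adjoin_insert_eq_sup (x : K) (S : Set K) :
    IntermediateField.adjoin F (insert x S) =
      IntermediateField.adjoin F {x} ⊔ IntermediateField.adjoin F S := by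
  rw [Set.insert_eq, IntermediateField.adjoin_union]

/-- **One application of the torsor crux, field form.** As `torsor_step`, but assuming only
`t ^ p ∈ F(A₀) = Frac A₀` (and `t ∈ O`): writing `t ^ p = r / s` with `r, s ∈ A₀`, the crux is
applied to `t' = t s`, for which `t' ^ p = r s^{p-1} ∈ A₀` and `F(A₀, t') = F(A₀, t)`. -/
theorem torsor_step_of_pow_mem_adjoin [Fact p.Prime] (A₀ : Subalgebra F K)
    (h₀ : A₀.toSubring ≤ O.toSubring) (hfg : A₀.FG)
    (hreg : IsRegularLocalRing (Localization.AtPrime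
      (Ideal.comap (Subring.inclusion h₀) (maximalIdeal O))))
    (t : K) (ht : t ∈ O) (htp : t ^ p ∈ IntermediateField.adjoin F (A₀ : Set K)) :
    ∃ (A : Subalgebra F K) (h : A.toSubring ≤ O.toSubring), A₀ ≤ A ∧ A.FG ∧
      IsRegularLocalRing (Localization.AtPrime
        (Ideal.comap (Subring.inclusion h) (maximalIdeal O))) ∧
      IntermediateField.adjoin F (A : Set K) =
        IntermediateField.adjoin F (insert t (A₀ : Set K)) := by
  classical
  obtain ⟨r, hr, s, hs, hrs⟩ := IntermediateField.mem_adjoin_iff_div.mp htp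
  rw [Algebra.adjoin_eq] at hr hs
  by_cases hs0 : s = 0
  · -- degenerate: `t = 0`
    have ht0 : t = 0 := by
      have : t ^ p = 0 := by rw [hrs, hs0, div_zero]
      exact (pow_eq_zero_iff (Nat.Prime.ne_zero Fact.out)).mp this
    refine ⟨A₀, h₀, le_rfl, hfg, hreg, ?_⟩
    rw [ht0]
    refine le_antisymm (IntermediateField.adjoin.mono F _ _ (Set.subset_insert _ _)) ?_
    rw [IntermediateField.adjoin_le_iff]
    rintro x (rfl | hx)
    · exact zero_mem _
    · exact IntermediateField.subset_adjoin F _ hx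
  · -- scale `t` by the denominator `s`
    set t' : K := t * s with ht'
    obtain ⟨m, hm⟩ : ∃ m : ℕ, p = m + 1 :=
      Nat.exists_eq_add_one_of_ne_zero (Nat.Prime.ne_zero Fact.out)
    have ht'p : t' ^ p ∈ A₀ := by
      have key : t' ^ p = r * s ^ m := by
        rw [ht', mul_pow, hrs, hm, pow_succ', ← mul_assoc, div_mul_cancel₀ r hs0]
      rw [key]
      exact mul_mem hr (pow_mem hs m)
    obtain ⟨A, h, hle, ht'A, hfgA, hregA, hadjA⟩ :=
      torsor_step hT O A₀ h₀ hfg hreg t' ht'p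
    refine ⟨A, h, hle, hfgA, hregA, ?_⟩
    rw [hadjA]
    refine le_antisymm ?_ ?_
    · rw [IntermediateField.adjoin_le_iff]
      rintro x (rfl | hx)
      · exact mul_mem (IntermediateField.subset_adjoin F _ (Set.mem_insert t _))
          (IntermediateField.subset_adjoin F _ (Set.mem_insert_of_mem t (hs : s ∈ (A₀ : Set K))))
      · exact IntermediateField.subset_adjoin F _ (Set.mem_insert_of_mem t hx)
    · rw [IntermediateField.adjoin_le_iff]
      rintro x (rfl | hx)
      · have hmem : t' * s⁻¹ ∈ IntermediateField.adjoin F (insert t' (A₀ : Set K)) :=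
          mul_mem (IntermediateField.subset_adjoin F _ (Set.mem_insert t' _))
            (inv_mem (IntermediateField.subset_adjoin F _
              (Set.mem_insert_of_mem t' (hs : s ∈ (A₀ : Set K)))))
        rwa [ht', mul_inv_cancel_right₀ hs0] at hmem
      · exact IntermediateField.subset_adjoin F _ (Set.mem_insert_of_mem t' hx)

/-- **Adjoining a `pⁿ`-th root.** If `A₀` is an `F`-chart (finitely generated `F`-subalgebra
of `O`, regular at the centre), `t ∈ O` and `t ^ p ^ n ∈ F(A₀)`, then `n` applications of the
crux (to `t^{p^{n-1}}, …, t^p, t`) give an `F`-chart `A ⊇ A₀` with `F(A) = F(A₀, t)`. -/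
theorem torsor_root [Fact p.Prime] (n : ℕ) :
    ∀ (A₀ : Subalgebra F K) (h₀ : A₀.toSubring ≤ O.toSubring), A₀.FG →
      IsRegularLocalRing (Localization.AtPrime
        (Ideal.comap (Subring.inclusion h₀) (maximalIdeal O))) →
      ∀ t : K, t ∈ O → t ^ p ^ n ∈ IntermediateField.adjoin F (A₀ : Set K) →
      ∃ (A : Subalgebra F K) (h : A.toSubring ≤ O.toSubring), A₀ ≤ A ∧ A.FG ∧
        IsRegularLocalRing (Localization.AtPrime
          (Ideal.comap (Subring.inclusion h) (maximalIdeal O))) ∧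
        IntermediateField.adjoin F (A : Set K) =
          IntermediateField.adjoin F (insert t (A₀ : Set K)) := by
  induction n with
  | zero =>
    intro A₀ h₀ hfg hreg t _ htp
    refine ⟨A₀, h₀, le_rfl, hfg, hreg, ?_⟩
    rw [pow_zero, pow_one] at htp
    refine le_antisymm (IntermediateField.adjoin.mono F _ _ (Set.subset_insert _ _)) ?_
    rw [IntermediateField.adjoin_le_iff]
    rintro x (rfl | hx)
    · exact htp
    · exact IntermediateField.subset_adjoin F _ hx
  | succ n ih =>
    intro A₀ h₀ hfg hreg t ht htp
    have htp' : (t ^ p) ^ p ^ n ∈ IntermediateField.adjoin F (A₀ : Set K) := by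
      rwa [← pow_mul, ← pow_succ']
    obtain ⟨A₁, h₁, hle₁, hfg₁, hreg₁, hadj₁⟩ := ih A₀ h₀ hfg hreg (t ^ p) (pow_mem ht p) htp'
    have htpA₁ : t ^ p ∈ IntermediateField.adjoin F (A₁ : Set K) := by
      rw [hadj₁]
      exact IntermediateField.subset_adjoin F _ (Set.mem_insert _ _)
    obtain ⟨A, h, hle, hfgA, hregA, hadjA⟩ :=
      torsor_step_of_pow_mem_adjoin hT O A₁ h₁ hfg₁ hreg₁ t ht htpA₁
    refine ⟨A, h, hle₁.trans hle, hfgA, hregA, ?_⟩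
    rw [hadjA, adjoin_insert_eq_sup, hadj₁, adjoin_insert_eq_sup, adjoin_insert_eq_sup, ← sup_assoc]
    congr 1
    refine le_antisymm (sup_le le_rfl ?_) le_sup_left
    rw [IntermediateField.adjoin_le_iff, Set.singleton_subset_iff]
    exact pow_mem (IntermediateField.subset_adjoin F _ (Set.mem_singleton t)) p

/-- **Adjoining finitely many `pⁿ`-th roots.** If `A₀` is an `F`-chart and `G ⊆ O` is a finite
set with `g ^ p ^ n ∈ F(A₀)` for all `g ∈ G`, there is an `F`-chart `A ⊇ A₀` with
`F(A) = F(A₀ ∪ G)`. -/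
theorem torsor_roots [Fact p.Prime] (n : ℕ) (G : Finset K) :
    ∀ (A₀ : Subalgebra F K) (h₀ : A₀.toSubring ≤ O.toSubring), A₀.FG →
      IsRegularLocalRing (Localization.AtPrime
        (Ideal.comap (Subring.inclusion h₀) (maximalIdeal O))) →
      (∀ g ∈ G, g ∈ O) → (∀ g ∈ G, g ^ p ^ n ∈ IntermediateField.adjoin F (A₀ : Set K)) →
      ∃ (A : Subalgebra F K) (h : A.toSubring ≤ O.toSubring), A₀ ≤ A ∧ A.FG ∧
        IsRegularLocalRing (Localization.AtPrime
          (Ideal.comap (Subring.inclusion h) (maximalIdeal O))) ∧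
        IntermediateField.adjoin F (A : Set K) =
          IntermediateField.adjoin F ((A₀ : Set K) ∪ G) := by
  classical
  induction G using Finset.induction_on with
  | empty =>
    intro A₀ h₀ hfg hreg _ _
    exact ⟨A₀, h₀, le_rfl, hfg, hreg, by simp⟩
  | insert g G hgG ih =>
    intro A₀ h₀ hfg hreg hGO hGp
    obtain ⟨A₁, h₁, hle₁, hfg₁, hreg₁, hadj₁⟩ := ih A₀ h₀ hfg hreg
      (fun x hx => hGO x (Finset.mem_insert_of_mem hx))
      (fun x hx => hGp x (Finset.mem_insert_of_mem hx))
    have hg : g ^ p ^ n ∈ IntermediateField.adjoin F (A₁ : Set K) :=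
      IntermediateField.adjoin.mono F _ _ (fun x hx => hle₁ hx) (hGp g (Finset.mem_insert_self g G))
    obtain ⟨A, h, hle, hfgA, hregA, hadjA⟩ :=
      torsor_root hT O n A₁ h₁ hfg₁ hreg₁ g (hGO g (Finset.mem_insert_self g G)) hg
    refine ⟨A, h, hle₁.trans hle, hfgA, hregA, ?_⟩
    rw [hadjA, Finset.coe_insert, adjoin_insert_eq_sup, hadj₁, Set.union_insert, adjoin_insert_eq_sup]

end

end Summit.ResolutionOfSingularities.ResolutionOfSingularities.Theorems

end
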